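import Literature.MathematicalPhysics.QuantumFieldTheory.Balaban1983to89.B9GradViaDivLettersAtPins
import Literature.MathematicalPhysics.QuantumFieldTheory.Balaban1983to89.B9SectDL2Decay

/-!
# `Balaban1983to89.B9GradViaDivLettersAtPinsL2` — [B9] (3.3) ∕ (3.8) ∕ (3.46) at node00-def-Y's letters: THE BLOCK-L² BOUNDS OF THE KINEMATIC LETTERS
# `J_μ(U)` (one transported neighbour value) AND `Π_ν` (direction-slice projector) of `B9GradViaDivLettersAtPins` — the `hJL2` ∕ `hPr` inputs of
# `B9Thm313WholeDvFromDds.gDv_l2_of_l2d ∕ dGDvd_l2_of_l4m ∕ dGDv_l2_of_l4m` at the N06 certificate's pins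

T. Bałaban, *Propagators for lattice gauge theories in a background field*, Commun. Math. Phys. **99** (1985) 389–434
[`Balaban1985BackgroundPropagators`, "B9"]; [4] = T. Bałaban, *Propagators and renormalization transformations for lattice gauge
theories. II*, Commun. Math. Phys. **96** (1984) 223–250 [`Balaban1984PropagatorsII`].

statement-level skeleton of published theorems with citation tags; proofs where landed; nothing here is a claim about the Yang–Mills
mass gap

THE PRINTED LOCUS.  (3.3) p. 390, (3.8) p. 392, (3.35) p. 396 (`U` is `G`-valued), (3.46) p. 398 (the block-L² lines *"‖1_{Δ(y)}·‖ … supp λ ⊂ Δ(y′)"*),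
p. 398 (remark after (3.47): *"replace ∇_U by ∇*_U"*), (3.152)–(3.153) p. 426; [4] (2.45)–(2.46) p. 231, (2.51) p. 232.

THE POINT.  `J_μ(U)` places ONE transported neighbour value into the `μ`-component: the output on the bond `b′` of direction `μ` reads the input at the
single site `chart(b′₋ + e_μ)`, and `b′ ↦ chart(b′₋ + e_μ)` is a bijection from the `μ`-directed bonds onto the sites; hence for an input supported in the
site block `Δ(y′)`, `Σ_{p ∈ Δ(y)} (J_μλ)(p)² ≤ (coordBound·basisBound)²·|κ|²·Σ_{q ∈ Δ(y′)} λ(q)²` (Cauchy–Schwarz only in the `|κ|` real coordinates of each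
slice, contracting link variables), i.e. `‖1_{Δ(y)}J_μλ‖₂ ≤ cR39 b·‖1_{Δ(y′)}λ‖₂`, and the left side vanishes unless `d(y, y′) ≤ rJ`:
* §1 `sum_sq_eq_bsq_of_loc`, `sum_bond_dir_shift_eq` (the re-indexing), `sq_JcoKH_apply_le`;
* §2 ★★ `blockBd_JcoKH` (kernel `cR39 b·e^{δ·rJ}·e^{−δd}`, every `δ ≥ 0`) and ★★ `blockBd_JcoKH_pins` (every member, every `Reg335` configuration, `trBasis N`);
* §3 ★ `blockBd_sliceProjK` — `Π_ν` is block-DIAGONAL and contracts each block square (kernel `1·e^{−δd}`, every `δ ≥ 0`).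

HONEST SCOPE.  Instance-side kinematic bookkeeping; nothing of [B9]'s propagator estimates asserted; COUNT-NEUTRAL; N06 NOT discharged; one finite lattice at a
time; nothing continuum, nothing about the mass gap.  Cell `pub-ymgap` (HUMAN RULING D-0062), Track A node N06 [B9], rows 20–21 (bundle F7), seat
`pub-ymgap-dag-n06-l` (g17), 2026-08-28.
-/

noncomputable section

namespace Literature.MathematicalPhysics.QuantumFieldTheory.Balaban1983to89.B9GradViaDivLettersAtPinsL2

open Node00 B6GlobalChartV1 B6KLevelCensusIndexV1 B9BackgroundsKLevelV1
open Node00.OpsYNablaBridge (chartY sum_bond_eq)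
open B9CoReadingCoords (XBK assembleK blkBK)
open B9CoReadingCoordsS (XSK blkSK sIK)
open LatticeFieldCalculus (shiftEquiv)
open B6Geom246MultiLevelTorus (geomT)
open B6Ineq2142KLevelV1 (β)
open B9GeoNormsKLevelV1 (geo9K)
open B9GeoLemma21KLevelV1 (geo9K_dist_self)
open B9Thm39ReadingCoords (cR39 cR39_nonneg coordBound39 basisBound39)
open B9Thm34Ext (toB6)
open B9SectDL2Decay (bsq bl2 bl2_nonneg bsq_nonneg bsq_eq_zero_of_loc BlockBd)
open B9GradViaDivLettersAtPins (Jb_apply JcoKH JcoKH_apply abs_JcoKH_apply_le rJ dist_bI_sIK_shift_le sliceProjK sliceProjK_apply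
  cfg_norm_le_one_of_reg335)

variable {𝔸 : Type} [NormedRing 𝔸] [NormedAlgebra ℂ 𝔸] [CompleteSpace 𝔸] [FiniteDimensional ℝ 𝔸]
variable {d ℓ : ℕ} {hd : 1 ≤ d + 1} {hL : Odd (ℓ + 1) ∧ 1 < ℓ + 1} {b₀ b₁ : ℝ}
variable (i : KIdx d ℓ hd hL b₀ b₁)

/-! ## §1 Bookkeeping: localised sums of squares, the re-indexing of the μ-directed bonds, the pointwise square bound -/

section L2

variable {κ : Type} [Fintype κ] (b : Module.Basis κ ℝ 𝔸) (B : B9.Backgrounds) (cfg : B.Cfg → CfgY 𝔸 i)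
variable {bI : FBondY i → IBondY i}

omit [Fintype κ] in
/-- the sum of squares of an input localised at the block `y′` is its block square there. [cite: Balaban1985BackgroundPropagators, (3.46) p.398 («supp λ ⊂ Δ(y′)»), bookkeeping] -/
theorem sum_sq_eq_bsq_of_loc {G : B6.Geometry} {Xc : Type} [Fintype Xc] (blk : Xc → G.Site) {y' : G.Site} {lam : Xc → ℝ}
    (hoff : ∀ q, blk q ≠ y' → lam q = 0) : ∑ q, lam q ^ 2 = bsq blk y' lam := by
  classical
  unfold bsq
  refine Finset.sum_congr rfl fun q _ => ?_
  split_ifs with hq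
  · rfl
  · rw [hoff q hq]; ring

omit [CompleteSpace 𝔸] [FiniteDimensional ℝ 𝔸] in
/-- **the μ-directed bonds re-indexed by their transported-neighbour site**: `Σ_{b′ : b′.dir = μ} g(chart(b′₋ + e_μ)) = Σ_z g(z)` (the shift and the chart are bijections).
[cite: Balaban1985BackgroundPropagators, (3.3) p.390, bookkeeping; Balaban1984PropagatorsII, (2.1) p.224] -/
theorem sum_bond_dir_shift_eq (μ : Fin (d + 1)) (gz : SiteY i → ℝ) :
    ∑ b' : FBondY i, (if b'.dir = μ then gz (chartY i (b'.src.shift μ)) else 0) = ∑ z : SiteY i, gz z := by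
  rw [sum_bond_eq]
  simp only [Finset.sum_ite_eq', Finset.mem_univ, if_true]
  exact Fintype.sum_equiv ((shiftEquiv (P := PV d ℓ i.m i.K hd hL) (j := 0) μ).trans (chartY i)) _ _ fun _ => rfl

/-- **the pointwise square bound**: `(J_μλ)(b′, ν, c, c′)² ≤ (coordBound·basisBound)²·|κ|·Σ_a λ(chart(b′₋+e_μ), ν, a, c′)²` on the bonds of direction `μ`, `0` elsewhere
(`abs_JcoKH_apply_le` squared, Cauchy–Schwarz in the coordinate `a`). [cite: Balaban1985BackgroundPropagators, (3.3) p.390, (3.35) p.396, p.389 (coordinates), dictionary] -/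
theorem sq_JcoKH_apply_le (μ : Fin (d + 1)) (U₁ : B.Cfg)
    (hU : ∀ (ν : Fin (d + 1)) (s : Site (PV d ℓ i.m i.K hd hL) 0), ‖(cfg U₁ ν s : 𝔸)‖ ≤ 1 ∧ ‖(((cfg U₁ ν s)⁻¹ : 𝔸ˣ) : 𝔸)‖ ≤ 1)
    (lam : XSK κ i → ℝ) (p : XBK κ i) :
    JcoKH i b B cfg μ U₁ lam p ^ 2 ≤
      if p.1.dir = μ then (coordBound39 b * basisBound39 b) ^ 2 * ((Fintype.card κ : ℝ) *
        ∑ a, lam (chartY i (p.1.src.shift μ), p.2.1, a, p.2.2.2) ^ 2) else 0 := by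
  by_cases h : p.1.dir = μ
  · rw [if_pos h]
    have h1 := abs_JcoKH_apply_le i b B cfg μ U₁ hU lam p
    have hcs := sq_sum_le_card_mul_sum_sq (s := (Finset.univ : Finset κ))
      (f := fun a => |lam (chartY i (p.1.src.shift μ), p.2.1, a, p.2.2.2)|)
    simp only [Finset.card_univ, sq_abs] at hcs
    calc JcoKH i b B cfg μ U₁ lam p ^ 2 = |JcoKH i b B cfg μ U₁ lam p| ^ 2 := (sq_abs _).symm
      _ ≤ (coordBound39 b * (basisBound39 b * ∑ a, |lam (chartY i (p.1.src.shift μ), p.2.1, a, p.2.2.2)|)) ^ 2 :=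
          pow_le_pow_left₀ (abs_nonneg _) h1 2
      _ = (coordBound39 b * basisBound39 b) ^ 2 * (∑ a, |lam (chartY i (p.1.src.shift μ), p.2.1, a, p.2.2.2)|) ^ 2 := by ring
      _ ≤ _ := mul_le_mul_of_nonneg_left hcs (sq_nonneg _)
  · rw [if_neg h, JcoKH_apply, Jb_apply, if_neg h, map_zero, Finsupp.zero_apply]
    simp

/-! ## §2 The block-L² bound of `J_μ(U₁)` -/

/-- ★★ **THE BLOCK-L² LETTER OF `J_μ(U₁)` AT THE PINS** (the `hJL2` input of `B9Thm313WholeDvFromDds`): for `bI` 1-faithful and contracting link variables,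
`‖1_{Δ(y)}J_μ(U₁)λ‖₂ ≤ (cR39 b·e^{δ·rJ})·e^{−δd(y,y′)}·‖1_{Δ(y′)}λ‖₂` (`supp λ ⊂ Δ(y′)`), every `δ ≥ 0` — each `μ`-directed bond of `Δ(y)` reads one site of `Δ(y′)`
(injectively), and none unless `d(y,y′) ≤ rJ`. [cite: Balaban1985BackgroundPropagators, (3.3) p.390, (3.35) p.396, (3.46) p.398, (3.152)–(3.153) p.426; Balaban1984PropagatorsII, (2.45)–(2.46) p.231] -/
theorem blockBd_JcoKH
    (hβ1 : ∀ f : FBondY i, (geomT i.D).dist (β i.hN i.D i.hk (bI f)) (blkV1 i.hN i.D f) ≤ 1) {U₁ : B.Cfg}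
    (hU : ∀ (ν : Fin (d + 1)) (s : Site (PV d ℓ i.m i.K hd hL) 0), ‖(cfg U₁ ν s : 𝔸)‖ ≤ 1 ∧ ‖(((cfg U₁ ν s)⁻¹ : 𝔸ˣ) : 𝔸)‖ ≤ 1)
    {δ : ℝ} (hδ : 0 ≤ δ) (R₀ : ℝ) (H₀ : Prop) [Fintype (geo9K i).Site] (μ : Fin (d + 1)) :
    BlockBd (g := toB6 (geo9K i) R₀ H₀) (blkSK i (sIK i bI)) (blkBK i bI) (JcoKH i b B cfg μ U₁)
      (fun y y' => cR39 b * Real.exp (δ * rJ d ℓ) * Real.exp (-(δ * (geo9K i).dist y y'))) := by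
  classical
  intro y' lam hoff y
  change IBondY i at y' y
  set C : ℝ := (coordBound39 b * basisBound39 b) ^ 2 * (Fintype.card κ : ℝ) with hC
  have hcb : 0 ≤ coordBound39 b := norm_nonneg _
  have hbb : 0 ≤ basisBound39 b := Finset.sum_nonneg fun _ _ => norm_nonneg _
  have hC0 : 0 ≤ C := by positivity
  set K : ℝ := cR39 b * Real.exp (δ * rJ d ℓ) * Real.exp (-(δ * (geo9K i).dist y y')) with hK
  have hK0 : 0 ≤ K := by have := cR39_nonneg b; positivity
  -- the slice-sum of squares of the input at a site
  set gz : SiteY i → ℝ := fun z => ∑ ν : Fin (d + 1), ∑ c' : κ, ∑ a : κ, lam (z, ν, a, c') ^ 2 with hgz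
  have hgz0 : ∀ z, 0 ≤ gz z := fun z => by positivity
  -- Σ_z gz z = the block square of the input at y′
  have hsumz : ∑ z, gz z = bsq (g := toB6 (geo9K i) R₀ H₀) (blkSK i (sIK i bI)) y' lam := by
    rw [← sum_sq_eq_bsq_of_loc (G := toB6 (geo9K i) R₀ H₀) (blkSK i (sIK i bI)) hoff]
    simp only [hgz, Fintype.sum_prod_type]
    refine Finset.sum_congr rfl fun z _ => Finset.sum_congr rfl fun ν _ => ?_
    rw [Finset.sum_comm]
  -- gz vanishes at the neighbour of a bond of Δ(y) unless y′ is within rJ of y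
  have hgzfar : ∀ b' : FBondY i, bI b' = y → ¬ (geo9K i).dist y y' ≤ rJ d ℓ → gz (chartY i (b'.src.shift μ)) = 0 := by
    intro b' hy hfar
    have hz : sIK i bI (chartY i (b'.src.shift μ)) ≠ y' := fun h => hfar (by
      rw [← hy, ← h]
      exact dist_bI_sIK_shift_le i hβ1 b'.src μ b'.dir)
    simp only [hgz]
    exact Finset.sum_eq_zero fun ν _ => Finset.sum_eq_zero fun c' _ => Finset.sum_eq_zero fun a _ => by
      rw [hoff (chartY i (b'.src.shift μ), ν, a, c') hz]; ring
  -- the block square of Jλ at y against the μ-directed bonds of Δ(y)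
  have hbsq : bsq (g := toB6 (geo9K i) R₀ H₀) (blkBK i bI) y (JcoKH i b B cfg μ U₁ lam) ≤
      C * (Fintype.card κ : ℝ) * ∑ b' : FBondY i, (if bI b' = y then (if b'.dir = μ then gz (chartY i (b'.src.shift μ)) else 0) else 0) := by
    unfold bsq
    rw [Finset.mul_sum, Fintype.sum_prod_type]
    refine Finset.sum_le_sum fun b' _ => ?_
    by_cases hy : bI b' = y
    · rw [if_pos hy]
      refine (Finset.sum_congr rfl fun t _ => if_pos (show blkBK i bI (b', t) = y from hy)).trans_le ?_
      by_cases hμ : b'.dir = μ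
      · rw [if_pos hμ]
        calc ∑ t : Fin (d + 1) × κ × κ, JcoKH i b B cfg μ U₁ lam (b', t) ^ 2
            ≤ ∑ t : Fin (d + 1) × κ × κ, C * ∑ a, lam (chartY i (b'.src.shift μ), t.1, a, t.2.2) ^ 2 :=
              Finset.sum_le_sum fun t _ => by
                have h := sq_JcoKH_apply_le i b B cfg μ U₁ hU lam (b', t)
                rw [if_pos hμ] at h
                simpa only [hC, mul_assoc] using h
          _ = C * ((Fintype.card κ : ℝ) * gz (chartY i (b'.src.shift μ))) := by
              rw [← Finset.mul_sum]
              congr 1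
              simp only [hgz, Fintype.sum_prod_type, Finset.sum_const, Finset.card_univ, nsmul_eq_mul, Finset.mul_sum]
          _ = C * (Fintype.card κ : ℝ) * gz (chartY i (b'.src.shift μ)) := by ring
      · rw [if_neg hμ, mul_zero]
        refine (Finset.sum_eq_zero fun t _ => ?_).le
        have h := sq_JcoKH_apply_le i b B cfg μ U₁ hU lam (b', t)
        rw [if_neg hμ] at h
        exact le_antisymm h (sq_nonneg _)
    · rw [if_neg hy, mul_zero]
      exact (Finset.sum_eq_zero fun t _ => if_neg (show ¬ blkBK i bI (b', t) = y from hy)).le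
  -- C·|κ| = (cR39 b)²
  have hCκ : C * (Fintype.card κ : ℝ) = cR39 b ^ 2 := by simp only [hC, cR39]; ring
  -- the block square bound: (K·‖1_{Δ(y′)}λ‖₂)²
  have hsq : bsq (g := toB6 (geo9K i) R₀ H₀) (blkBK i bI) y (JcoKH i b B cfg μ U₁ lam) ≤
      (K * bl2 (g := toB6 (geo9K i) R₀ H₀) (blkSK i (sIK i bI)) y' lam) ^ 2 := by
    have hb0 : 0 ≤ bsq (g := toB6 (geo9K i) R₀ H₀) (blkSK i (sIK i bI)) y' lam := bsq_nonneg _ _ _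
    by_cases hnear : (geo9K i).dist y y' ≤ rJ d ℓ
    · have hK1 : 1 ≤ Real.exp (δ * rJ d ℓ) * Real.exp (-(δ * (geo9K i).dist y y')) := by
        rw [← Real.exp_add]
        exact Real.one_le_exp (by nlinarith [mul_le_mul_of_nonneg_left hnear hδ])
      have hdrop : ∑ b' : FBondY i, (if bI b' = y then (if b'.dir = μ then gz (chartY i (b'.src.shift μ)) else 0) else 0) ≤
          bsq (g := toB6 (geo9K i) R₀ H₀) (blkSK i (sIK i bI)) y' lam := by
        rw [← hsumz, ← sum_bond_dir_shift_eq i μ gz]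
        refine Finset.sum_le_sum fun b' _ => ?_
        split_ifs with h1 h2
        · exact le_rfl
        · exact le_rfl
        · exact hgz0 _
        · exact le_rfl
      calc bsq (g := toB6 (geo9K i) R₀ H₀) (blkBK i bI) y (JcoKH i b B cfg μ U₁ lam)
          ≤ C * (Fintype.card κ : ℝ) * bsq (g := toB6 (geo9K i) R₀ H₀) (blkSK i (sIK i bI)) y' lam :=
            hbsq.trans (mul_le_mul_of_nonneg_left hdrop (mul_nonneg hC0 (Nat.cast_nonneg _)))
        _ = (cR39 b * 1) ^ 2 * bsq (g := toB6 (geo9K i) R₀ H₀) (blkSK i (sIK i bI)) y' lam := by rw [hCκ, mul_one]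
        _ ≤ K ^ 2 * bsq (g := toB6 (geo9K i) R₀ H₀) (blkSK i (sIK i bI)) y' lam := by
            refine mul_le_mul_of_nonneg_right (pow_le_pow_left₀ (mul_nonneg (cR39_nonneg b) zero_le_one) ?_ 2) hb0
            calc cR39 b * 1 ≤ cR39 b * (Real.exp (δ * rJ d ℓ) * Real.exp (-(δ * (geo9K i).dist y y'))) :=
                  mul_le_mul_of_nonneg_left hK1 (cR39_nonneg b)
              _ = K := by rw [hK, mul_assoc]
        _ = _ := by rw [mul_pow K, B9SectDL2Decay.bl2_sq]
    · have hzero : ∑ b' : FBondY i, (if bI b' = y then (if b'.dir = μ then gz (chartY i (b'.src.shift μ)) else 0) else 0) = 0 :=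
        Finset.sum_eq_zero fun b' _ => by
          split_ifs with h1 h2
          · exact hgzfar b' h1 hnear
          · rfl
          · rfl
      calc bsq (g := toB6 (geo9K i) R₀ H₀) (blkBK i bI) y (JcoKH i b B cfg μ U₁ lam) ≤ 0 := by
            have h := hbsq; rw [hzero, mul_zero] at h; exact h
        _ ≤ _ := sq_nonneg _
  have hR0 : 0 ≤ K * bl2 (g := toB6 (geo9K i) R₀ H₀) (blkSK i (sIK i bI)) y' lam := mul_nonneg hK0 (bl2_nonneg _ _ _)
  calc bl2 (g := toB6 (geo9K i) R₀ H₀) (blkBK i bI) y (JcoKH i b B cfg μ U₁ lam)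
      = Real.sqrt (bsq (g := toB6 (geo9K i) R₀ H₀) (blkBK i bI) y (JcoKH i b B cfg μ U₁ lam)) := rfl
    _ ≤ Real.sqrt ((K * bl2 (g := toB6 (geo9K i) R₀ H₀) (blkSK i (sIK i bI)) y' lam) ^ 2) := Real.sqrt_le_sqrt hsq
    _ = _ := Real.sqrt_sq hR0

end L2

/-! ## §3 The block-L² bound of the slice projector `Π_ν` (diagonal, contracting) -/

section Proj

variable {κ : Type} [Fintype κ]

omit [CompleteSpace 𝔸] [FiniteDimensional ℝ 𝔸] [NormedAlgebra ℂ 𝔸] [NormedRing 𝔸] in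
/-- ★ **THE BLOCK-L² LETTER OF `Π_ν`** (the `hPr` input of `B9Thm313WholeDvFromDds.dGDv_l2_of_l4m`): `‖1_{Δ(y)}Π_νf‖₂ ≤ ‖1_{Δ(y)}f‖₂` and `Π_ν` preserves supports, so for
`supp f ⊂ Δ(y′)` the kernel `1·e^{−δd(y,y′)}` (every `δ ≥ 0`; `d(y,y) = 0`) serves. [cite: Balaban1985BackgroundPropagators, (3.46) p.398, (3.42) p.397 (all directions); Balaban1984PropagatorsII, (2.51) p.232] -/
theorem blockBd_sliceProjK {δ : ℝ} (R₀ : ℝ) (H₀ : Prop) [Fintype (geo9K i).Site] (blk : XBK κ i → IBondY i) (ν : Fin (d + 1)) :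
    BlockBd (g := toB6 (geo9K i) R₀ H₀) blk blk (sliceProjK (κ := κ) ν)
      (fun y y' => (1 : ℝ) * Real.exp (-(δ * (geo9K i).dist y y'))) := by
  classical
  intro y' f hoff y
  change IBondY i at y' y
  by_cases hy : y = y'
  · subst hy
    show _ ≤ (1 : ℝ) * Real.exp (-(δ * (geo9K i).dist y y)) * _
    rw [geo9K_dist_self, mul_zero, neg_zero, Real.exp_zero, one_mul, one_mul]
    have hsq : bsq (g := toB6 (geo9K i) R₀ H₀) blk y (sliceProjK (κ := κ) ν f) ≤ bsq (g := toB6 (geo9K i) R₀ H₀) blk y f := by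
      unfold bsq
      refine Finset.sum_le_sum fun p _ => ?_
      split_ifs with hp
      · rw [sliceProjK_apply]
        split_ifs
        · exact le_rfl
        · simpa using sq_nonneg (f p)
      · exact le_rfl
    exact Real.sqrt_le_sqrt hsq
  · have h0 : bsq (g := toB6 (geo9K i) R₀ H₀) blk y (sliceProjK (κ := κ) ν f) = 0 :=
      bsq_eq_zero_of_loc (g := toB6 (geo9K i) R₀ H₀) blk hy _ fun p hp => by
        rw [sliceProjK_apply, hoff p hp, ite_self]
    show Real.sqrt _ ≤ _
    rw [h0, Real.sqrt_zero]
    exact mul_nonneg (by positivity) (bl2_nonneg _ _ _)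

end Proj

/-! ## §4 At node00-def-Y's members: the block-L² letter of `J_μ(U)` at the certificate's pins -/

section Members

open scoped Matrix.Norms.L2Operator
open B7Prop2SpecialUnitary (specialUnitaryUnits)
open B9PinMembersKLevelV1 (MemberY geo9Y bg9Y)
open B9CoReadingCoordsTranspose (TrIdx trBasis)

variable {Mstar : ℕ} {N : ℕ} [NeZero N]
variable [∀ x : MemberY d ℓ hd hL b₀ b₁ Mstar, Fintype (geo9Y x).Site]

/-- ★★ **THE BLOCK-L² LETTER `J_μ(U)` AT THE CERTIFICATE'S PINS, EVERY MEMBER, EVERY REGULAR `U`** (the knit's `hJL2_12 x U μ`):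
`BlockBd (blkSK (sIK (bI x))) (blkBK (bI x)) (J_μ(U)) (cR39 (trBasis N)·e^{δ·rJ}·e^{−δd})`, every `δ ≥ 0`.
[cite: Balaban1985BackgroundPropagators, (3.3) p.390, (3.35) p.396, (3.46) p.398, (3.152)–(3.153) p.426; Balaban1984PropagatorsII, (2.45)–(2.46) p.231] -/
theorem blockBd_JcoKH_pins (x : MemberY d ℓ hd hL b₀ b₁ Mstar) {bI : FBondY x.toKIdx → IBondY x.toKIdx}
    (hβ1 : ∀ f : FBondY x.toKIdx, (geomT x.D).dist (β x.hN x.D x.hk (bI f)) (blkV1 x.hN x.D f) ≤ 1) {c α₀ : ℝ}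
    {U : (bg9Y (Matrix (Fin N) (Fin N) ℂ) (specialUnitaryUnits (Fin N)) x).Cfg}
    (hU : (bg9Y (Matrix (Fin N) (Fin N) ℂ) (specialUnitaryUnits (Fin N)) x).Reg335 c α₀ U)
    {δ : ℝ} (hδ : 0 ≤ δ) (R₀ : ℝ) (H₀ : Prop) (μ : Fin (d + 1)) :
    BlockBd (g := toB6 (geo9Y x) R₀ H₀) (blkSK x.toKIdx (sIK x.toKIdx bI)) (blkBK x.toKIdx bI)
      (JcoKH x.toKIdx (trBasis N) (bg9Y (Matrix (Fin N) (Fin N) ℂ) (specialUnitaryUnits (Fin N)) x) (fun U => U) μ U)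
      (fun y y' => cR39 (trBasis N) * Real.exp (δ * rJ d ℓ) * Real.exp (-(δ * (geo9Y x).dist y y'))) := by
  letI : Fintype (geo9K x.toKIdx).Site := (inferInstance : Fintype (geo9Y x).Site)
  exact blockBd_JcoKH x.toKIdx (trBasis N) (bg9Y (Matrix (Fin N) (Fin N) ℂ) (specialUnitaryUnits (Fin N)) x) (fun U => U)
    hβ1 (cfg_norm_le_one_of_reg335 x hU) hδ R₀ H₀ μ

end Members

end Literature.MathematicalPhysics.QuantumFieldTheory.Balaban1983to89.B9GradViaDivLettersAtPinsL2

end
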